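import Mathlib
import Summits.MatrixMultiplication.MatrixMultiplication.Theses.SemilatticeSTPP
import Summits.MatrixMultiplication.MatrixMultiplication.Theorems.SemilatticeSTPPThesisCountingBounds
import Summits.MatrixMultiplication.MatrixMultiplication.Theorems.SemilatticeSTPPThesisSmallHosts

/-!
# Line `registered` of crux `SemilatticeSTPP.Thesis` (stmt-MatrixMultiplication-5969):
# no semilattice volume beat in hosts with at most ten elements

Hosts here are SEMILATTICES = finite commutative idempotent monoids (product = join, identity `1` = bottom).
For a monoid-TPP family in iff-form with block shapes `⟨aᵢ, bᵢ, cᵢ⟩` and block weights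
`sᵢ := 2·[1 ≤ bᵢ] aᵢcᵢ + [2 ≤ bᵢ ∧ 1 ≤ cᵢ] aᵢbᵢ + [2 ≤ bᵢ ∧ 1 ≤ aᵢ] bᵢcᵢ`, the counting bounds of
`…CountingBounds` give `Σ sᵢ ≤ 2|M|`, and a volume beat forces a block `i` with `2aᵢbᵢcᵢ > sᵢ`, hence
`1 ≤ aᵢ, 2 ≤ bᵢ, 1 ≤ cᵢ` and `sᵢ ≥ 19` (`…SmallHosts`).  This file sharpens `2|M| ≥ 19` to `2|M| ≥ 21` using
the bottom element:

* `gamma_ne_one_of_idempotent` — a γ-value of a block with `b ≥ 2` is never `1`: `α·β = γ = 1` forces `α = 1`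
  (`α = α·1 = α·α·β = α·β`), contradicting `alpha_ne_one_of_idempotent`.
* `card_ge_gamma_add_alpha_add_one_of_idempotent`, `card_ge_gamma_add_beta_add_one_of_idempotent` — if NO
  γ-value of a block with `b ≥ 1` is `1`, the injections behind the two counting bounds miss `1`
  (`alpha_ne_one_of_idempotent`, `beta_ne_one_of_idempotent`), so both bounds improve by one.
* `shape_of_weight_lt_two_mul_volume` — `2abc > s` forces `1 ≤ a`, `2 ≤ b`, `1 ≤ c`.
* `volume_le_card_of_card_le_ten` — if no γ-value over `b ≥ 1` is `1`, then `Σ sⱼ + 2 ≤ 2|M|`; otherwise the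
  block `k` with `γ = 1` has `b_k = 1`, so `k ≠ i` and `s_k ≥ 2a_kc_k ≥ 2`; either way `2|M| ≥ sᵢ + 2 ≥ 21`,
  i.e. `|M| ≥ 11`: no semilattice host with `|M| ≤ 10` carries a volume beat.  (The bound is sharp for this
  method only: the first shape multiset passing all counting filters is `⟨2,3,2⟩` at `|M| = 11`.)

Mathlib + the route file + the counting-bounds / small-hosts files only; no cited facts; sorry-free.
-/

set_option linter.dupNamespace false
-- (single-conjunct summit: the namespace repeats `MatrixMultiplication`)

namespace Summit.MatrixMultiplication.MatrixMultiplication.Theorems.SemilatticeSTPPThesis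

open Summit.MatrixMultiplication.MatrixMultiplication.Theorems.Thesis.Negative.SemilatticeSTPPVolumeFloor

/-- **γ-values over `b ≥ 2` avoid the identity.**  In a commutative idempotent host of a monoid-TPP family
(iff-form), a γ-value `γ(k;s,u)` of a block with `2 ≤ b k` is never `1`: with `t = 0` the matched identity
`α(k;s,t)·β(k;t,u) = γ(k;s,u) = 1` gives `α(k;s,t) = α·1 = α·α·β = α·β = 1`, contradicting
`alpha_ne_one_of_idempotent` (note `0 < c k` as `u : Fin (c k)`). [folklore] -/
theorem gamma_ne_one_of_idempotent :
    ∀ (M : Type) [CommMonoid M], (∀ v : M, v * v = v) →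
      ∀ (p : ℕ) (a b c : Fin p → ℕ) (α : (Σ i, Fin (a i) × Fin (b i)) → M)
        (β : (Σ i, Fin (b i) × Fin (c i)) → M) (γ : (Σ i, Fin (a i) × Fin (c i)) → M),
        (∀ x y z, α x * β y = γ z ↔
          (z.1 = x.1 ∧ x.1 = y.1 ∧ (z.2.1 : ℕ) = x.2.1 ∧ (x.2.2 : ℕ) = y.2.1 ∧ (z.2.2 : ℕ) = y.2.2)) →
        ∀ (z : Σ i, Fin (a i) × Fin (c i)), 2 ≤ b z.1 → γ z ≠ 1 := by
  intro M _ hid p a b c α β γ htpp z hbz hone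
  obtain ⟨k, s, u⟩ := z
  simp only at hbz
  set t : Fin (b k) := ⟨0, by omega⟩
  have hm : α ⟨k, (s, t)⟩ * β ⟨k, (t, u)⟩ = γ ⟨k, (s, u)⟩ :=
    (htpp ⟨k, (s, t)⟩ ⟨k, (t, u)⟩ ⟨k, (s, u)⟩).2 ⟨rfl, rfl, rfl, rfl, rfl⟩
  have hα : α ⟨k, (s, t)⟩ = 1 :=
    calc α ⟨k, (s, t)⟩ = α ⟨k, (s, t)⟩ * (α ⟨k, (s, t)⟩ * β ⟨k, (t, u)⟩) := by rw [hm, hone, mul_one]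
      _ = 1 := by rw [← mul_assoc, hid (α ⟨k, (s, t)⟩), hm, hone]
  exact alpha_ne_one_of_idempotent M hid p a b c α β γ htpp ⟨k, (s, t)⟩ hbz u.pos hα

/-- **Counting bound `#Z + #X + 1 ≤ |M|` off the bottom.**  If no γ-value of a block with `1 ≤ b i` is the
identity, then the γ-values over the blocks with `1 ≤ b i`, the α-values over the blocks with
`2 ≤ b i ∧ 1 ≤ c i` (never `1` by `alpha_ne_one_of_idempotent`) and the identity itself are pairwise distinct
(injectivity and disjointness as in `card_ge_gamma_add_alpha_of_idempotent`), so
`Σ_{1 ≤ bᵢ} aᵢcᵢ + Σ_{2 ≤ bᵢ, 1 ≤ cᵢ} aᵢbᵢ + 1 ≤ |M|`. [folklore] -/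
theorem card_ge_gamma_add_alpha_add_one_of_idempotent :
    ∀ (M : Type) [CommMonoid M] [Fintype M], (∀ v : M, v * v = v) →
      ∀ (p : ℕ) (a b c : Fin p → ℕ) (α : (Σ i, Fin (a i) × Fin (b i)) → M)
        (β : (Σ i, Fin (b i) × Fin (c i)) → M) (γ : (Σ i, Fin (a i) × Fin (c i)) → M),
        (∀ x y z, α x * β y = γ z ↔
          (z.1 = x.1 ∧ x.1 = y.1 ∧ (z.2.1 : ℕ) = x.2.1 ∧ (x.2.2 : ℕ) = y.2.1 ∧ (z.2.2 : ℕ) = y.2.2)) →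
        (∀ z : Σ i, Fin (a i) × Fin (c i), 1 ≤ b z.1 → γ z ≠ 1) →
        (∑ i, if 1 ≤ b i then a i * c i else 0) + (∑ i, if 2 ≤ b i ∧ 1 ≤ c i then a i * b i else 0) + 1
          ≤ Fintype.card M := by
  intro M _ _ hid p a b c α β γ htpp hZ
  classical
  set S : Finset (Fin p) := Finset.univ.filter (fun i => 1 ≤ b i) with hS
  set T : Finset (Fin p) := Finset.univ.filter (fun i => 2 ≤ b i ∧ 1 ≤ c i) with hT
  -- the identity, the γ-values over `S`, and the α-values over `T`
  let φ : Option ((Σ i : S, Fin (a i) × Fin (c i)) ⊕ (Σ i : T, Fin (a i) × Fin (b i))) → M :=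
    fun o => o.elim 1 (Sum.elim (fun w => γ ⟨w.1.1, w.2⟩) (fun w => α ⟨w.1.1, w.2⟩))
  have hφ : Function.Injective φ := by
    rintro (_ | ⟨⟨⟨i, hi⟩, su⟩ | ⟨⟨i, hi⟩, st⟩⟩) (_ | ⟨⟨⟨i', hi'⟩, su'⟩ | ⟨⟨i', hi'⟩, st'⟩⟩) he
    · rfl
    · -- the identity against a γ-value
      exact absurd (Eq.symm he) (hZ ⟨i', su'⟩ (Finset.mem_filter.mp hi').2)
    · -- the identity against an α-value
      exact absurd (Eq.symm he) (alpha_ne_one_of_idempotent M hid p a b c α β γ htpp ⟨i', st'⟩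
        (Finset.mem_filter.mp hi').2.1 (Finset.mem_filter.mp hi').2.2)
    · -- a γ-value against the identity
      exact absurd he (hZ ⟨i, su⟩ (Finset.mem_filter.mp hi).2)
    · -- two γ-values
      have hb : 0 < b i := (Finset.mem_filter.mp hi).2
      have key := gamma_injective_of_tpp α β γ htpp ⟨i, su⟩ ⟨i', su'⟩ hb he
      obtain ⟨rfl, h2⟩ := Sigma.mk.inj_iff.mp key
      cases h2
      rfl
    · -- a γ-value against an α-value
      exact absurd (Eq.symm he) (alpha_ne_gamma_of_idempotent M hid p a b c α β γ htpp ⟨i', st'⟩ ⟨i, su⟩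
        (Finset.mem_filter.mp hi').2.1 (Finset.mem_filter.mp hi).2)
    · -- an α-value against the identity
      exact absurd he (alpha_ne_one_of_idempotent M hid p a b c α β γ htpp ⟨i, st⟩
        (Finset.mem_filter.mp hi).2.1 (Finset.mem_filter.mp hi).2.2)
    · -- an α-value against a γ-value
      exact absurd he (alpha_ne_gamma_of_idempotent M hid p a b c α β γ htpp ⟨i, st⟩ ⟨i', su'⟩
        (Finset.mem_filter.mp hi).2.1 (Finset.mem_filter.mp hi').2)
    · -- two α-values
      have hc : 0 < c i := (Finset.mem_filter.mp hi).2.2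
      have key := alpha_injective_of_tpp α β γ htpp ⟨i, st⟩ ⟨i', st'⟩ hc he
      obtain ⟨rfl, h2⟩ := Sigma.mk.inj_iff.mp key
      cases h2
      rfl
  have hcard : Fintype.card (Option ((Σ i : S, Fin (a i) × Fin (c i)) ⊕ (Σ i : T, Fin (a i) × Fin (b i))))
      = ∑ i ∈ S, a i * c i + ∑ i ∈ T, a i * b i + 1 := by
    rw [Fintype.card_option, Fintype.card_sum, Fintype.card_sigma, Fintype.card_sigma,
      ← Finset.sum_coe_sort S (fun i => a i * c i), ← Finset.sum_coe_sort T (fun i => a i * b i)]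
    simp only [Fintype.card_prod, Fintype.card_fin]
  have hsum : (∑ i, if 1 ≤ b i then a i * c i else 0) + (∑ i, if 2 ≤ b i ∧ 1 ≤ c i then a i * b i else 0) + 1
      = ∑ i ∈ S, a i * c i + ∑ i ∈ T, a i * b i + 1 := by
    rw [hS, hT, Finset.sum_filter, Finset.sum_filter]
  rw [hsum, ← hcard]
  exact Fintype.card_le_of_injective φ hφ

/-- **Counting bound `#Z + #Y + 1 ≤ |M|` off the bottom.**  The twin of
`card_ge_gamma_add_alpha_add_one_of_idempotent` with β in place of α: if no γ-value of a block with `1 ≤ b i`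
is the identity, then the γ-values over the blocks with `1 ≤ b i`, the β-values over the blocks with
`2 ≤ b i ∧ 1 ≤ a i` (never `1` by `beta_ne_one_of_idempotent`) and the identity are pairwise distinct, so
`Σ_{1 ≤ bᵢ} aᵢcᵢ + Σ_{2 ≤ bᵢ, 1 ≤ aᵢ} bᵢcᵢ + 1 ≤ |M|`. [folklore] -/
theorem card_ge_gamma_add_beta_add_one_of_idempotent :
    ∀ (M : Type) [CommMonoid M] [Fintype M], (∀ v : M, v * v = v) →
      ∀ (p : ℕ) (a b c : Fin p → ℕ) (α : (Σ i, Fin (a i) × Fin (b i)) → M)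
        (β : (Σ i, Fin (b i) × Fin (c i)) → M) (γ : (Σ i, Fin (a i) × Fin (c i)) → M),
        (∀ x y z, α x * β y = γ z ↔
          (z.1 = x.1 ∧ x.1 = y.1 ∧ (z.2.1 : ℕ) = x.2.1 ∧ (x.2.2 : ℕ) = y.2.1 ∧ (z.2.2 : ℕ) = y.2.2)) →
        (∀ z : Σ i, Fin (a i) × Fin (c i), 1 ≤ b z.1 → γ z ≠ 1) →
        (∑ i, if 1 ≤ b i then a i * c i else 0) + (∑ i, if 2 ≤ b i ∧ 1 ≤ a i then b i * c i else 0) + 1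
          ≤ Fintype.card M := by
  intro M _ _ hid p a b c α β γ htpp hZ
  classical
  set S : Finset (Fin p) := Finset.univ.filter (fun i => 1 ≤ b i) with hS
  set T : Finset (Fin p) := Finset.univ.filter (fun i => 2 ≤ b i ∧ 1 ≤ a i) with hT
  -- the identity, the γ-values over `S`, and the β-values over `T`
  let φ : Option ((Σ i : S, Fin (a i) × Fin (c i)) ⊕ (Σ i : T, Fin (b i) × Fin (c i))) → M :=
    fun o => o.elim 1 (Sum.elim (fun w => γ ⟨w.1.1, w.2⟩) (fun w => β ⟨w.1.1, w.2⟩))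
  have hφ : Function.Injective φ := by
    rintro (_ | ⟨⟨⟨i, hi⟩, su⟩ | ⟨⟨i, hi⟩, tu⟩⟩) (_ | ⟨⟨⟨i', hi'⟩, su'⟩ | ⟨⟨i', hi'⟩, tu'⟩⟩) he
    · rfl
    · -- the identity against a γ-value
      exact absurd (Eq.symm he) (hZ ⟨i', su'⟩ (Finset.mem_filter.mp hi').2)
    · -- the identity against a β-value
      exact absurd (Eq.symm he) (beta_ne_one_of_idempotent M hid p a b c α β γ htpp ⟨i', tu'⟩
        (Finset.mem_filter.mp hi').2.1 (Finset.mem_filter.mp hi').2.2)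
    · -- a γ-value against the identity
      exact absurd he (hZ ⟨i, su⟩ (Finset.mem_filter.mp hi).2)
    · -- two γ-values
      have hb : 0 < b i := (Finset.mem_filter.mp hi).2
      have key := gamma_injective_of_tpp α β γ htpp ⟨i, su⟩ ⟨i', su'⟩ hb he
      obtain ⟨rfl, h2⟩ := Sigma.mk.inj_iff.mp key
      cases h2
      rfl
    · -- a γ-value against a β-value
      exact absurd (Eq.symm he) (beta_ne_gamma_of_idempotent M hid p a b c α β γ htpp ⟨i', tu'⟩ ⟨i, su⟩
        (Finset.mem_filter.mp hi').2.1 (Finset.mem_filter.mp hi).2)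
    · -- a β-value against the identity
      exact absurd he (beta_ne_one_of_idempotent M hid p a b c α β γ htpp ⟨i, tu⟩
        (Finset.mem_filter.mp hi).2.1 (Finset.mem_filter.mp hi).2.2)
    · -- a β-value against a γ-value
      exact absurd he (beta_ne_gamma_of_idempotent M hid p a b c α β γ htpp ⟨i, tu⟩ ⟨i', su'⟩
        (Finset.mem_filter.mp hi).2.1 (Finset.mem_filter.mp hi').2)
    · -- two β-values
      have ha : 0 < a i := (Finset.mem_filter.mp hi).2.2
      have key := beta_injective_of_tpp α β γ htpp ⟨i, tu⟩ ⟨i', tu'⟩ ha he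
      obtain ⟨rfl, h2⟩ := Sigma.mk.inj_iff.mp key
      cases h2
      rfl
  have hcard : Fintype.card (Option ((Σ i : S, Fin (a i) × Fin (c i)) ⊕ (Σ i : T, Fin (b i) × Fin (c i))))
      = ∑ i ∈ S, a i * c i + ∑ i ∈ T, b i * c i + 1 := by
    rw [Fintype.card_option, Fintype.card_sum, Fintype.card_sigma, Fintype.card_sigma,
      ← Finset.sum_coe_sort S (fun i => a i * c i), ← Finset.sum_coe_sort T (fun i => b i * c i)]
    simp only [Fintype.card_prod, Fintype.card_fin]
  have hsum : (∑ i, if 1 ≤ b i then a i * c i else 0) + (∑ i, if 2 ≤ b i ∧ 1 ≤ a i then b i * c i else 0) + 1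
      = ∑ i ∈ S, a i * c i + ∑ i ∈ T, b i * c i + 1 := by
    rw [hS, hT, Finset.sum_filter, Finset.sum_filter]
  rw [hsum, ← hcard]
  exact Fintype.card_le_of_injective φ hφ

/-- **Shape of a block beating its weight.**  If `2abc` exceeds the block weight
`s = 2·[1 ≤ b] ac + [2 ≤ b ∧ 1 ≤ c] ab + [2 ≤ b ∧ 1 ≤ a] bc`, then `1 ≤ a`, `2 ≤ b`, `1 ≤ c`: each of the
degenerate shapes `a = 0`, `b ≤ 1`, `c = 0` gives `s = 2abc`. [folklore] -/
theorem shape_of_weight_lt_two_mul_volume (a b c : ℕ)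
    (h : ¬ 2 * (a * b * c) ≤ 2 * (if 1 ≤ b then a * c else 0) + (if 2 ≤ b ∧ 1 ≤ c then a * b else 0)
        + (if 2 ≤ b ∧ 1 ≤ a then b * c else 0)) : 1 ≤ a ∧ 2 ≤ b ∧ 1 ≤ c := by
  refine ⟨?_, ?_, ?_⟩ <;> by_contra hh <;> apply h
  · obtain rfl : a = 0 := by omega
    simp
  · have hb2 : b < 2 := not_le.mp hh
    interval_cases b <;> simp
  · obtain rfl : c = 0 := by omega
    simp

/-- **No semilattice volume beat below eleven elements.**  In a finite commutative idempotent host `M` with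
`|M| ≤ 10`, every monoid-TPP family (iff-form) has volume `Σ aᵢbᵢcᵢ ≤ |M|`.  Proof: with the block weights
`sᵢ = 2·[1 ≤ bᵢ] aᵢcᵢ + [2 ≤ bᵢ ∧ 1 ≤ cᵢ] aᵢbᵢ + [2 ≤ bᵢ ∧ 1 ≤ aᵢ] bᵢcᵢ` the counting bounds give
`Σ sᵢ ≤ 2|M|`; if every block has `2aᵢbᵢcᵢ ≤ sᵢ` we are done, otherwise some block `i` has `sᵢ ≥ 19`
(`two_mul_volume_le_weight_or_nineteen_le_weight`) and `1 ≤ aᵢ, 2 ≤ bᵢ, 1 ≤ cᵢ`.  If no γ-value over the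
blocks with `b ≥ 1` is the identity, the sharpened bounds `card_ge_gamma_add_{alpha,beta}_add_one_of_idempotent`
give `Σ sⱼ + 2 ≤ 2|M|`; otherwise a block `k` with `γ(k;s,u) = 1` has `b k = 1` (`gamma_ne_one_of_idempotent`),
so `k ≠ i` and `s_k ≥ 2 a_k c_k ≥ 2`.  Either way `21 ≤ sᵢ + 2 ≤ 2|M| ≤ 20`, absurd. [folklore] -/
theorem volume_le_card_of_card_le_ten :
    ∀ (M : Type) [CommMonoid M] [Fintype M], (∀ v : M, v * v = v) →
      ∀ (p : ℕ) (a b c : Fin p → ℕ) (α : (Σ i, Fin (a i) × Fin (b i)) → M)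
        (β : (Σ i, Fin (b i) × Fin (c i)) → M) (γ : (Σ i, Fin (a i) × Fin (c i)) → M),
        (∀ x y z, α x * β y = γ z ↔
          (z.1 = x.1 ∧ x.1 = y.1 ∧ (z.2.1 : ℕ) = x.2.1 ∧ (x.2.2 : ℕ) = y.2.1 ∧ (z.2.2 : ℕ) = y.2.2)) →
        Fintype.card M ≤ 10 → ∑ i, a i * b i * c i ≤ Fintype.card M := by
  intro M _ _ hid p a b c α β γ htpp hM
  have hA := card_ge_gamma_add_alpha_of_idempotent M hid p a b c α β γ htpp
  have hB := card_ge_gamma_add_beta_of_idempotent M hid p a b c α β γ htpp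
  -- the per-block weights `sᵢ` and their total `Σ sᵢ = 2·S₀ + S₁ + S₂`
  have hsum : ∑ i, (2 * (if 1 ≤ b i then a i * c i else 0) + (if 2 ≤ b i ∧ 1 ≤ c i then a i * b i else 0)
      + (if 2 ≤ b i ∧ 1 ≤ a i then b i * c i else 0)) = 2 * (∑ i, if 1 ≤ b i then a i * c i else 0)
      + (∑ i, if 2 ≤ b i ∧ 1 ≤ c i then a i * b i else 0) + (∑ i, if 2 ≤ b i ∧ 1 ≤ a i then b i * c i else 0) := by
    rw [Finset.sum_add_distrib, Finset.sum_add_distrib, ← Finset.mul_sum]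
  by_cases hall : ∀ i, 2 * (a i * b i * c i) ≤ 2 * (if 1 ≤ b i then a i * c i else 0)
      + (if 2 ≤ b i ∧ 1 ≤ c i then a i * b i else 0) + (if 2 ≤ b i ∧ 1 ≤ a i then b i * c i else 0)
  · -- every block is dominated by its weight: `2·Σ aᵢbᵢcᵢ ≤ Σ sᵢ ≤ 2|M|`
    have hV : 2 * ∑ i, a i * b i * c i ≤ ∑ i, (2 * (if 1 ≤ b i then a i * c i else 0)
        + (if 2 ≤ b i ∧ 1 ≤ c i then a i * b i else 0) + (if 2 ≤ b i ∧ 1 ≤ a i then b i * c i else 0)) := by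
      rw [Finset.mul_sum]
      exact Finset.sum_le_sum fun i _ => hall i
    omega
  · -- some block `i` beats its weight: `sᵢ ≥ 19` and `1 ≤ aᵢ, 2 ≤ bᵢ, 1 ≤ cᵢ`
    obtain ⟨i, hi⟩ := not_forall.mp hall
    have h19 : 19 ≤ 2 * (if 1 ≤ b i then a i * c i else 0) + (if 2 ≤ b i ∧ 1 ≤ c i then a i * b i else 0)
        + (if 2 ≤ b i ∧ 1 ≤ a i then b i * c i else 0) :=
      (two_mul_volume_le_weight_or_nineteen_le_weight (a i) (b i) (c i)).resolve_left hi
    obtain ⟨-, hbi, -⟩ := shape_of_weight_lt_two_mul_volume (a i) (b i) (c i) hi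
    by_cases hZ : ∀ z : Σ i, Fin (a i) × Fin (c i), 1 ≤ b z.1 → γ z ≠ 1
    · -- no γ-value over `b ≥ 1` is the bottom: both counting bounds improve by one
      have hA1 := card_ge_gamma_add_alpha_add_one_of_idempotent M hid p a b c α β γ htpp hZ
      have hB1 := card_ge_gamma_add_beta_add_one_of_idempotent M hid p a b c α β γ htpp hZ
      have hle : 2 * (if 1 ≤ b i then a i * c i else 0) + (if 2 ≤ b i ∧ 1 ≤ c i then a i * b i else 0)
          + (if 2 ≤ b i ∧ 1 ≤ a i then b i * c i else 0) ≤ ∑ j, (2 * (if 1 ≤ b j then a j * c j else 0)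
          + (if 2 ≤ b j ∧ 1 ≤ c j then a j * b j else 0) + (if 2 ≤ b j ∧ 1 ≤ a j then b j * c j else 0)) :=
        Finset.single_le_sum (f := fun j => 2 * (if 1 ≤ b j then a j * c j else 0)
          + (if 2 ≤ b j ∧ 1 ≤ c j then a j * b j else 0) + (if 2 ≤ b j ∧ 1 ≤ a j then b j * c j else 0))
          (fun j _ => Nat.zero_le _) (Finset.mem_univ i)
      omega
    · -- some γ-value `γ(k;s,u) = 1` with `1 ≤ b k`: then `b k = 1`, `k ≠ i`, and `s_k ≥ 2 a_k c_k ≥ 2`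
      obtain ⟨⟨k, s, u⟩, hk⟩ := not_forall.mp hZ
      obtain ⟨hbk, hγ⟩ := Classical.not_imp.mp hk
      have hγ1 : γ ⟨k, (s, u)⟩ = 1 := of_not_not hγ
      simp only at hbk
      have hbk1 : b k = 1 := by
        by_contra hne
        exact gamma_ne_one_of_idempotent M hid p a b c α β γ htpp ⟨k, (s, u)⟩ (by simp only; omega) hγ1
      have hki : k ≠ i := by
        rintro rfl
        omega
      have hsk : 2 ≤ 2 * (if 1 ≤ b k then a k * c k else 0) + (if 2 ≤ b k ∧ 1 ≤ c k then a k * b k else 0)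
          + (if 2 ≤ b k ∧ 1 ≤ a k then b k * c k else 0) := by
        have hac : 1 ≤ a k * c k := Nat.one_le_iff_ne_zero.mpr (Nat.mul_ne_zero s.pos.ne' u.pos.ne')
        simp only [hbk1, le_refl, if_true]
        omega
      have hpair : (2 * (if 1 ≤ b i then a i * c i else 0) + (if 2 ≤ b i ∧ 1 ≤ c i then a i * b i else 0)
          + (if 2 ≤ b i ∧ 1 ≤ a i then b i * c i else 0)) + (2 * (if 1 ≤ b k then a k * c k else 0)
          + (if 2 ≤ b k ∧ 1 ≤ c k then a k * b k else 0) + (if 2 ≤ b k ∧ 1 ≤ a k then b k * c k else 0))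
          ≤ ∑ j, (2 * (if 1 ≤ b j then a j * c j else 0) + (if 2 ≤ b j ∧ 1 ≤ c j then a j * b j else 0)
          + (if 2 ≤ b j ∧ 1 ≤ a j then b j * c j else 0)) := by
        classical
        rw [← Finset.sum_pair (f := fun j => 2 * (if 1 ≤ b j then a j * c j else 0)
          + (if 2 ≤ b j ∧ 1 ≤ c j then a j * b j else 0) + (if 2 ≤ b j ∧ 1 ≤ a j then b j * c j else 0))
          hki.symm]
        exact Finset.sum_le_sum_of_subset (Finset.subset_univ _)
      omega

end Summit.MatrixMultiplication.MatrixMultiplication.Theorems.SemilatticeSTPPThesis
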